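import Summits.BirchSwinnertonDyer.BirchSwinnertonDyer.Theorems.ManinLocalTwoThreeShimuraQuotientRational
import HarnessLib

/-!
# The Shimura quotient as a GROUP: an additive map `Λ₀(f) → W₁(ℚ)` with kernel exactly `Λ₁(f)` and torsion image
# (modulo the cusp-rationality fact F★)

Summit `BirchSwinnertonDyer`, route `ManinLocalTwoThree` (cell bsd-f2-manin), cruxes C2 `ManinOddAtFour` (stmt-BirchSwinnertonDyer-22967) /
C3 `ManinPrimeToThreeAtNine` (stmt-…-22968); prover seat bsd-line-manin23-p1 (C2/C3 LEAD), gen 10.  Sequel to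
`…ShimuraQuotientRational.lean`: there F★ = `optimalGamma1Parametrization_cusp_rational` gave, prime by prime, a rational point of order `p` on
Stevens' curve for each `p ∣ [Λ₀(f) : Λ₁(f)]`.  Here the whole quotient at once:

* `exists_hom_periodLattice_to_points` — for an OPTIMAL `X₁(N)`-datum `D` of `W` there is an additive map `ι : Λ₀(f) →+ W(ℚ)` with
  `ι(x) ↦ D.uniformize (c·x)` under base change to `ℂ`, whose KERNEL is exactly `Λ₁(f)` (optimality `Λ_E = c Λ₁(f)`) and whose values are
  torsion points (killed by `φ(N)`): **`Λ₀(f)/Λ₁(f)` is isomorphic to a subgroup of `W₁(ℚ)_tors`** — the constancy of the kernel of the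
  Shimura cover `E₁ → E₀` (Ling–Oesterlé 1991 Thm. 1 / Vatsal 2005 Rem. 1.8: `E₀ ∩ Σ(N)` is of `μ`-type, so its Cartier dual is constant), in the
  tree's lattice language and from the printed cusp-rationality input only.
* `mem_periodLatticeGamma1_iff_of_hom` — the kernel statement unpacked.

HONEST FRAMING: structure only, conditional on F★; no Manin constant is decided; C2, C3, Manin's conjecture and BSD are NOT proved by this file.
No definitions (the map is produced existentially), no sorry.
-/

set_option autoImplicit false
set_option linter.dupNamespace false

noncomputable section

open scoped Classical MatrixGroups ModularForm

open CongruenceSubgroup Complex WeierstrassCurve Literature.NumberTheory.EllipticCurves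
  Literature.NumberTheory.EllipticCurves.ModularForms

namespace Summit.BirchSwinnertonDyer.BirchSwinnertonDyer.Theorems.ManinLocalTwoThree

variable {W : WeierstrassCurve ℚ} [W.IsElliptic] {N : ℕ} [NeZero N]

/-- **The Shimura quotient embeds in the rational torsion of Stevens' curve, as a group** (F★-conditional): for an OPTIMAL `X₁(N)`-datum
`D` of `W` there is an additive `ι : Λ₀(f) →+ W(ℚ)` such that (i) `ι x` base-changes to `D.uniformize (c·x)`, (ii) `ι x = 0 ↔ x ∈ Λ₁(f)`,
(iii) `φ(N) • ι x = 0`.  Hence `Λ₀(f)/Λ₁(f) ≅ ι(Λ₀(f)) ≤ W(ℚ)_tors`. [cite: ConradEdixhovenStein2003, §6.1.2 and §6.2] [cite: LingOesterle1991, Thm. 1]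
[cite: Stevens1989, §2] -/
theorem exists_hom_periodLattice_to_points (hF : optimalGamma1Parametrization_cusp_rational)
    (D : Gamma1ParametrizationData W N) (hD : D.IsOptimal) :
    ∃ ι : periodLattice D.f →+ (W.baseChange ℚ).toAffine.Point,
      (∀ x : periodLattice D.f, Affine.Point.baseChange (W' := W) ℚ ℂ (ι x) = D.uniformize ((D.c : ℂ) * x)) ∧
      (∀ x : periodLattice D.f, ι x = 0 ↔ (x : ℂ) ∈ periodLatticeGamma1 D.f) ∧
      (∀ x : periodLattice D.f, Nat.totient N • ι x = 0) := by
  have hinj := Affine.Point.map_injective (W' := W) (f := Algebra.ofId ℚ ℂ)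
  have hc : (D.c : ℂ) ≠ 0 := by exact_mod_cast D.maninConstant_ne_zero
  -- the pointwise choice
  have hP : ∀ x : periodLattice D.f, ∃ P : (W.baseChange ℚ).toAffine.Point,
      Affine.Point.baseChange (W' := W) ℚ ℂ P = D.uniformize ((D.c : ℂ) * x) :=
    fun x ↦ exists_point_eq_uniformize_of_mem_periodLattice hF D hD x.2
  choose P hPspec using hP
  -- additivity through the injective base change
  have hadd : ∀ x y : periodLattice D.f, P (x + y) = P x + P y := by
    intro x y
    apply hinj
    change Affine.Point.baseChange (W' := W) ℚ ℂ (P (x + y)) = Affine.Point.baseChange (W' := W) ℚ ℂ (P x + P y)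
    rw [map_add, hPspec, hPspec, hPspec, AddSubgroup.coe_add, mul_add, map_add]
  have hzero : P 0 = 0 := by
    have h := hadd 0 0
    rw [add_zero] at h
    exact left_eq_add.mp h
  let ι : periodLattice D.f →+ (W.baseChange ℚ).toAffine.Point :=
    { toFun := P, map_zero' := hzero, map_add' := hadd }
  refine ⟨ι, fun x ↦ hPspec x, fun x ↦ ?_, fun x ↦ ?_⟩
  · -- kernel = Λ₁(f)
    change P x = 0 ↔ _
    constructor
    · intro h0
      have h1 : D.uniformize ((D.c : ℂ) * x) = 0 := by rw [← hPspec x, h0, map_zero]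
      rw [gamma1_uniformize_eq_zero_iff] at h1
      obtain ⟨w, hw, hcw⟩ := hD _ h1
      rwa [mul_left_cancel₀ hc hcw]
    · intro hx
      apply hinj
      change Affine.Point.baseChange (W' := W) ℚ ℂ (P x) = Affine.Point.baseChange (W' := W) ℚ ℂ 0
      rw [map_zero, hPspec, gamma1_uniformize_eq_zero_iff]
      exact D.smul_periodLatticeGamma1_le _ hx
  · -- torsion: `φ(N) • P x = 0`
    apply hinj
    change Affine.Point.baseChange (W' := W) ℚ ℂ (Nat.totient N • P x) = Affine.Point.baseChange (W' := W) ℚ ℂ 0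
    rw [map_nsmul, map_zero, hPspec]
    exact totient_nsmul_uniformize_eq_zero D x.2

omit [W.IsElliptic] in
/-- The kernel statement unpacked: for an optimal `X₁(N)`-datum and `x ∈ Λ₀(f)`, the rational point over `D.uniformize (c·x)` vanishes
iff `x ∈ Λ₁(f)`; so `[Λ₀(f) : Λ₁(f)]` is the order of a subgroup of `W(ℚ)_tors` (Mazur's bound applies). [cite: Stevens1989, §2] -/
theorem uniformize_mul_eq_zero_iff_mem_periodLatticeGamma1 (D : Gamma1ParametrizationData W N) (hD : D.IsOptimal) (x : ℂ) : D.uniformize ((D.c : ℂ) * x) = 0 ↔ x ∈ periodLatticeGamma1 D.f := by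
  have hc : (D.c : ℂ) ≠ 0 := by exact_mod_cast D.maninConstant_ne_zero
  rw [gamma1_uniformize_eq_zero_iff]
  constructor
  · intro h
    obtain ⟨w, hw, hcw⟩ := hD _ h
    rwa [mul_left_cancel₀ hc hcw]
  · exact fun h ↦ D.smul_periodLatticeGamma1_le _ h

end Summit.BirchSwinnertonDyer.BirchSwinnertonDyer.Theorems.ManinLocalTwoThree

end
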